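import Mathlib.RingTheory.Filtration
import Mathlib.RingTheory.Noetherian.Basic
import Mathlib.LinearAlgebra.Quotient.Basic
import HarnessLib

/-!
# `p`-power torsion in Noetherian modules: bounded exponent, exact eigenvectors, content bounds

Topic `Algebra/Module`; namespace `Literature.Algebra.Module`.  Theorems only (Mathlib-only
imports; no definition, no named fact, no instance, no `sorry`).

Three pieces of module-theoretic bookkeeping from the proof of [Scholze2015, Thm. V.4.1 /
Cor. V.4.2] ("`H^i(X_K, ℳ_{ξ,K})` is a finitely generated module … the eigensystem occurs
integrally"), isolated over a commutative ring `R`, an element `p ∈ R` and an `R`-module `H`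
(there: `R = 𝒪_E`, `H = H^q(X_K, M̃)`, `W = H^q(X_K, Ṽ) = H[1/p]`):

* `exists_forall_pow_smul_eq_zero` — in a NOETHERIAN module the `p`-power torsion has bounded
  exponent: some `p^e` kills every `p`-power torsion element (the kernels of `p^m` stabilise);
* `exists_smul_eigenvector_of_ker_torsion` — if `f : H → W` is `R`-linear with `p`-power-torsion
  kernel and intertwines endomorphisms `S j` of `H` with `S' j` of `W`, and `f c₀` is a simultaneous
  eigenvector of the `S' j` with eigenvalues `χ j ∈ R`, then `c = p^e c₀` is an EXACT simultaneous
  eigenvector of the `S j` in `H` (and `f c = p^e f c₀`);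
* `exists_content_bound` — over a Noetherian LOCAL ring with `p` in the maximal ideal and `H`
  finitely generated, an element `c` which is not `p`-power torsion has BOUNDED CONTENT: there is
  `m₀` with `p^u c ≠ p^{u+m₀} y` for all `u`, `y` (Krull's intersection theorem in `H/H[p^∞]`,
  Mathlib `Ideal.iInf_pow_smul_eq_bot_of_isLocalRing`); `not_torsion_of_map_ne_zero` supplies the
  hypothesis from `f c ≠ 0` in a `p`-torsion-free `W`.

## References

* P. Scholze, *On torsion in the cohomology of locally symmetric varieties*, Ann. of Math. 182
  (2015), §V.4, proof of Thm. V.4.1 [Scholze2015].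
* N. Bourbaki, *Algèbre commutative*, Ch. III §3 (Krull's intersection theorem). [folklore]
-/

namespace Literature.Algebra.Module

variable {R : Type*} [CommRing R] {H : Type*} [AddCommGroup H] [Module R H]

/-! ### Bounded exponent of the `p`-power torsion -/

/-- **In a Noetherian module the `p`-power torsion has bounded exponent**: there is `e` such that
`p^m z = 0` for some `m` implies `p^e z = 0` (the ascending chain `ker p^m` stabilises). [folklore] -/
theorem exists_forall_pow_smul_eq_zero [IsNoetherian R H] (p : R) :
    ∃ e : ℕ, ∀ (z : H) (m : ℕ), p ^ m • z = 0 → p ^ e • z = 0 := by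
  let f : ℕ →o Submodule R H :=
    { toFun := fun m => LinearMap.ker (LinearMap.lsmul R H (p ^ m))
      monotone' := fun m m' h z hz => by
        simp only [LinearMap.mem_ker, LinearMap.lsmul_apply] at hz ⊢
        obtain ⟨d, rfl⟩ := Nat.exists_eq_add_of_le h
        rw [add_comm, pow_add, mul_smul, hz, smul_zero] }
  obtain ⟨e, he⟩ := (monotone_stabilizes_iff_noetherian.2 inferInstance) f
  refine ⟨e, fun z m hz => ?_⟩
  rcases le_or_gt m e with h | h
  · obtain ⟨d, rfl⟩ := Nat.exists_eq_add_of_le h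
    rw [add_comm, pow_add, mul_smul, hz, smul_zero]
  · have hf : ∀ (k : ℕ) (w : H), w ∈ f k ↔ p ^ k • w = 0 := fun k w => by
      change w ∈ LinearMap.ker (LinearMap.lsmul R H (p ^ k)) ↔ _
      rw [LinearMap.mem_ker, LinearMap.lsmul_apply]
    have hmem : z ∈ f m := (hf m z).2 hz
    rw [← he m h.le] at hmem
    exact (hf e z).1 hmem

/-! ### Exact eigenvectors from eigenvectors modulo `p`-power torsion -/

/-- **An eigenvector of `W` coming from `H` has a `p`-power multiple which is an exact eigenvector in
`H`**, when `ker (f : H → W)` is `p`-power torsion of bounded exponent.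
[cite: Scholze2015, §V.4 (proof of Thm. V.4.1)] -/
theorem exists_smul_eigenvector_of_ker_torsion [IsNoetherian R H] (p : R) {W : Type*}
    [AddCommGroup W] [Module R W] (f : H →ₗ[R] W)
    (hf : ∀ z : H, f z = 0 → ∃ m : ℕ, p ^ m • z = 0) {J : Type*} (S : J → Module.End R H)
    (S' : J → Module.End R W) (hS : ∀ (j : J) (z : H), f (S j z) = S' j (f z)) (χ : J → R)
    (c₀ : H) (hc₀ : ∀ j, S' j (f c₀) = χ j • f c₀) :
    ∃ e : ℕ, ∀ j, S j (p ^ e • c₀) = χ j • (p ^ e • c₀) := by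
  obtain ⟨e, he⟩ := exists_forall_pow_smul_eq_zero (H := H) p
  refine ⟨e, fun j => ?_⟩
  have hz : f (S j c₀ - χ j • c₀) = 0 := by
    rw [map_sub, map_smul, hS, hc₀, sub_self]
  obtain ⟨m, hm⟩ := hf _ hz
  have h0 := he _ m hm
  rw [smul_sub, sub_eq_zero, smul_comm] at h0
  rw [map_smul, h0, smul_comm]

/-! ### Content bounds -/

/-- If `f c ≠ 0` for an `R`-linear `f : H → W` into a module without `p`-torsion, then `c` is not
`p`-power torsion. [folklore] -/
theorem not_torsion_of_map_ne_zero (p : R) {W : Type*} [AddCommGroup W] [Module R W]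
    (hW : ∀ w : W, p • w = 0 → w = 0) (f : H →ₗ[R] W) {c : H} (hc : f c ≠ 0) (m : ℕ) :
    p ^ m • c ≠ 0 := by
  intro h
  apply hc
  have key : ∀ (m : ℕ) (w : W), p ^ m • w = 0 → w = 0 := by
    intro m
    induction m with
    | zero => intro w hw; simpa using hw
    | succ m ih =>
      intro w hw
      rw [pow_succ, mul_smul] at hw
      exact hW _ (ih _ hw)
  exact key m (f c) (by rw [← map_pow_smul_eq f, h, map_zero])
where
  map_pow_smul_eq (f : H →ₗ[R] W) : f (p ^ m • c) = p ^ m • f c := map_smul f _ _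

/-- **Bounded content.**  Over a Noetherian local ring `R` with `p` in the maximal ideal, in a
finitely generated module `H`, an element `c` which is not `p`-power torsion satisfies
`p^u c ≠ p^{u+m₀} y` for all `u, y`, for some `m₀`: otherwise `c ≡ p^{m₀} y` modulo the `p`-power
torsion `T = H[p^e]` for every `m₀`, so the image of `c` in `H/T` lies in `⋂ p^{m₀}(H/T) = 0`
(Krull's intersection theorem), i.e. `c ∈ T`. [cite: Scholze2015, §V.4 (proof of Thm. V.4.1)] -/
theorem exists_content_bound [IsNoetherianRing R] [IsLocalRing R] [Module.Finite R H] {p : R}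
    (hp : p ∈ IsLocalRing.maximalIdeal R) (c : H) (hc : ∀ m : ℕ, p ^ m • c ≠ 0) :
    ∃ m₀ : ℕ, ∀ (u : ℕ) (y : H), p ^ u • c ≠ p ^ (u + m₀) • y := by
  obtain ⟨e, he⟩ := exists_forall_pow_smul_eq_zero (H := H) p
  -- the `p`-power torsion `T = ker p^e` and the quotient `H/T`
  let T : Submodule R H := LinearMap.ker (LinearMap.lsmul R H (p ^ e))
  have hT : ∀ z : H, z ∈ T ↔ p ^ e • z = 0 := fun z => by
    simp only [T, LinearMap.mem_ker, LinearMap.lsmul_apply]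
  by_contra hcon
  push Not at hcon
  -- `c ≡ p^{m₀} y (mod T)` for every `m₀`
  have hmem : ∀ m₀ : ℕ, T.mkQ c ∈ ((Ideal.span {p}) ^ m₀ • ⊤ : Submodule R (H ⧸ T)) := by
    intro m₀
    obtain ⟨u, y, hy⟩ := hcon m₀
    have hdiff : c - p ^ m₀ • y ∈ T := by
      rw [hT]
      apply he _ u
      rw [smul_sub, hy, pow_add, mul_smul, sub_self]
    have heq : T.mkQ c = p ^ m₀ • T.mkQ y := by
      rw [← map_smul, ← sub_eq_zero, ← map_sub, Submodule.mkQ_apply, Submodule.Quotient.mk_eq_zero]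
      exact hdiff
    rw [heq, Ideal.span_singleton_pow]
    exact Submodule.smul_mem_smul (Ideal.mem_span_singleton_self _) Submodule.mem_top
  have hI : (Ideal.span {p} : Ideal R) ≠ ⊤ := fun h =>
    IsLocalRing.maximalIdeal.isMaximal R |>.ne_top
      (top_le_iff.1 (h ▸ (Ideal.span_le.2 (Set.singleton_subset_iff.2 hp))))
  have hbot := Ideal.iInf_pow_smul_eq_bot_of_isLocalRing (I := Ideal.span {p}) (M := H ⧸ T) hI
  have h0 : T.mkQ c = 0 := by
    rw [← Submodule.mem_bot R, ← hbot, Submodule.mem_iInf]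
    exact hmem
  rw [Submodule.mkQ_apply, Submodule.Quotient.mk_eq_zero, hT] at h0
  exact hc e h0

end Literature.Algebra.Module
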